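import Literature.AlgebraicGeometry.Motives.QuadricSurfaceLines
import Literature.AlgebraicGeometry.Motives.QuadraticFormHessian
import Mathlib.LinearAlgebra.QuadraticForm.IsometryEquiv
import Mathlib.LinearAlgebra.Matrix.NonsingularInverse
import Mathlib.FieldTheory.IsAlgClosed.Basic
import Mathlib.Algebra.MvPolynomial.Funext
import HarnessLib

/-!
# Normal form of a nonsingular quadric surface; Tian–Zong Thm. 1.7 for quadric surfaces

Over an algebraically closed field `k` of characteristic `≠ 2`, a quadratic form `F(x₀, …, x₃)`
satisfying the Jacobian criterion (`IsNonsingularSystem`, i.e. `V₊(F) ⊆ ℙ³` is a smooth quadric)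
is projectively equivalent to `x₀x₃ - x₁x₂`: there is an invertible linear substitution `τ` with
`σ_τ(x₀x₃ - x₁x₂) = F` (`exists_linearSubst_stdQuadric`). Steps: the Hessian matrix `M` of `F`
(`Mⱼₗ =` coefficient of `xₗ` in `∂F/∂xⱼ`) is symmetric with `2F(v) = vᵀMv` (Euler's identity,
Mathlib `IsHomogeneous.sum_X_mul_pderiv`) and nondegenerate (a kernel vector would be a singular
point of the cone, contradicting the Jacobian criterion at the prime `ker (eval v)`); Mathlib's
diagonalisation of quadratic forms (`equivalent_weightedSumSquares_units_of_nondegenerate'`)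
and square roots in `k` bring `vᵀMv` to `Σ uᵢ²`, and `u₀² + u₁² + u₂² + u₃² = 2(y₀y₃ - y₁y₂)` for
`y₀ = u₀ + iu₁, 2y₃ = u₀ - iu₁, y₁ = u₂ + iu₃, -2y₂ = u₂ - iu₃` (`i² = -1`).

Consequence (`TianZong2014_chowOne_generatedByLines_quadricSurface`): the named fact
`TianZong2014_chowOne_generatedByLines` holds for `n = 2, c = 1, d = 2` — `CH₁` of a smooth
quadric surface over an algebraically closed field of characteristic zero is generated by lines
(`Motives/QuadricSurfaceLines`).

Everything is proved; no named facts.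

## References

* [TianZong2014] Z. Tian, H. R. Zong, *One-cycles on rationally connected varieties*, Thm. 1.7.
* R. Hartshorne, *Algebraic Geometry*, I Ex. 5.8 (Jacobian criterion), II Example 6.6.1. [Hartshorne1977]
* J.-P. Serre, *A Course in Arithmetic*, IV §1 (quadratic forms over fields). [folklore]
-/

noncomputable section

open CategoryTheory AlgebraicGeometry Order

universe u

namespace Literature.AlgebraicGeometry.Motives

namespace ProjectiveSpaceCells

open _root_.MvPolynomial Matrix



/-! ### The normal form `x₀x₃ - x₁x₂` -/

section NormalForm

variable {k : Type u} [Field k]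

/-- The function `u₀u₃ - u₁u₂` (= evaluation of `stdQuadric`). [folklore] -/
theorem eval_stdQuadric (u : Fin (3 + 1) → k) :
    MvPolynomial.eval u (stdQuadric k) = u 0 * u 3 - u 1 * u 2 := by
  simp [stdQuadric]

/-- **`Σ sᵢ²uᵢ² = 2(y₀y₃ - y₁y₂)`**: the explicit linear map `u ↦ y` with
`y₀ = s₀u₀ + c s₁u₁`, `y₃ = (s₀u₀ - c s₁u₁)/2`, `y₁ = s₂u₂ + c s₃u₃`, `y₂ = -(s₂u₂ - c s₃u₃)/2`
(`c² = -1`). [folklore] -/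
def toStdQuadricMap (s : Fin (3 + 1) → k) (c : k) : (Fin (3 + 1) → k) →ₗ[k] (Fin (3 + 1) → k) where
  toFun u := ![s 0 * u 0 + c * (s 1 * u 1), s 2 * u 2 + c * (s 3 * u 3),
    -((s 2 * u 2 - c * (s 3 * u 3)) * (2 : k)⁻¹), (s 0 * u 0 - c * (s 1 * u 1)) * (2 : k)⁻¹]
  map_add' u u' := by
    ext i; fin_cases i <;> simp <;> ring
  map_smul' a u := by
    ext i; fin_cases i <;> simp <;> ring

/-- Auxiliary computation (`toStdQuadricMap_apply_zero`). [folklore] -/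
theorem toStdQuadricMap_apply_zero (s : Fin (3 + 1) → k) (c : k) (u : Fin (3 + 1) → k) :
    toStdQuadricMap s c u 0 = s 0 * u 0 + c * (s 1 * u 1) := rfl

/-- Auxiliary computation (`toStdQuadricMap_apply_one`). [folklore] -/
theorem toStdQuadricMap_apply_one (s : Fin (3 + 1) → k) (c : k) (u : Fin (3 + 1) → k) :
    toStdQuadricMap s c u 1 = s 2 * u 2 + c * (s 3 * u 3) := rfl

/-- Auxiliary computation (`toStdQuadricMap_apply_two`). [folklore] -/
theorem toStdQuadricMap_apply_two (s : Fin (3 + 1) → k) (c : k) (u : Fin (3 + 1) → k) :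
    toStdQuadricMap s c u 2 = -((s 2 * u 2 - c * (s 3 * u 3)) * (2 : k)⁻¹) := rfl

/-- Auxiliary computation (`toStdQuadricMap_apply_three`). [folklore] -/
theorem toStdQuadricMap_apply_three (s : Fin (3 + 1) → k) (c : k) (u : Fin (3 + 1) → k) :
    toStdQuadricMap s c u 3 = (s 0 * u 0 - c * (s 1 * u 1)) * (2 : k)⁻¹ := rfl

/-- `q₀(L u) = ½ Σ sᵢ² uᵢ²`. [folklore] -/
theorem eval_stdQuadric_toStdQuadricMap (s : Fin (3 + 1) → k) {c : k} (hc : c * c = -1)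
    (h2 : (2 : k) ≠ 0) (u : Fin (3 + 1) → k) :
    MvPolynomial.eval (toStdQuadricMap s c u) (stdQuadric k) =
      (2 : k)⁻¹ * ∑ i, s i * s i * (u i * u i) := by
  rw [eval_stdQuadric, toStdQuadricMap_apply_zero, toStdQuadricMap_apply_one,
    toStdQuadricMap_apply_two, toStdQuadricMap_apply_three, Fin.sum_univ_four]
  have h2' : (2 : k)⁻¹ * 2 = 1 := inv_mul_cancel₀ h2
  linear_combination (-(2 : k)⁻¹ * (s 1 * u 1) ^ 2 - (2 : k)⁻¹ * (s 3 * u 3) ^ 2) * hc +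
    ((2 : k)⁻¹ * ((s 0 * u 0) ^ 2 + (s 1 * u 1) ^ 2 + (s 2 * u 2) ^ 2 + (s 3 * u 3) ^ 2) -
      ((s 0 * u 0) ^ 2 + (s 1 * u 1) ^ 2 + (s 2 * u 2) ^ 2 + (s 3 * u 3) ^ 2) * (2 : k)⁻¹) * h2'

/-- The map `u ↦ y` is injective (`sᵢ ≠ 0`, `c ≠ 0`... only `sᵢ ≠ 0` and `2 ≠ 0` are needed).
[folklore] -/
theorem toStdQuadricMap_injective {s : Fin (3 + 1) → k} (hs : ∀ i, s i ≠ 0) {c : k}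
    (hc : c * c = -1) (h2 : (2 : k) ≠ 0) : Function.Injective (toStdQuadricMap s c) := by
  have hc0 : c ≠ 0 := by rintro rfl; simp at hc
  rw [← LinearMap.ker_eq_bot, LinearMap.ker_eq_bot']
  intro u hu
  have h := congrFun hu
  have h0 := h 0; have h1 := h 1; have h2' := h 2; have h3 := h 3
  rw [toStdQuadricMap_apply_zero, Pi.zero_apply] at h0
  rw [toStdQuadricMap_apply_one, Pi.zero_apply] at h1
  rw [toStdQuadricMap_apply_two, Pi.zero_apply, neg_eq_zero, mul_eq_zero, inv_eq_zero,
    or_iff_left h2] at h2'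
  rw [toStdQuadricMap_apply_three, Pi.zero_apply, mul_eq_zero, inv_eq_zero, or_iff_left h2] at h3
  have htwo : ∀ x : k, 2 * x = 0 → x = 0 := fun x hx ↦ (mul_eq_zero.mp hx).resolve_left h2
  have hu0 : s 0 * u 0 = 0 := htwo _ (by linear_combination h0 + h3)
  have hu1 : c * (s 1 * u 1) = 0 := htwo _ (by linear_combination h0 - h3)
  have hu2 : s 2 * u 2 = 0 := htwo _ (by linear_combination h1 + h2')
  have hu3 : c * (s 3 * u 3) = 0 := htwo _ (by linear_combination h1 - h2')
  simp only [mul_eq_zero, hs, hc0, false_or] at hu0 hu1 hu2 hu3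
  ext i; fin_cases i <;> assumption

variable [IsAlgClosed k]

/-- **Normal form of a nonsingular quadratic form in four variables** over an algebraically closed
field of characteristic `≠ 2`: there is an invertible matrix `A` with `F(v) = q₀(A v)` for all
`v`, `q₀ = x₀x₃ - x₁x₂`. [cite: Hartshorne1977, I Ex. 5.8] -/
theorem exists_matrix_eval_eq_eval_stdQuadric (h2 : (2 : k) ≠ 0) {F : MvPolynomial (Fin (3 + 1)) k}
    (hF : F.IsHomogeneous 2) (hJ : IsNonsingularSystem k (fun _ : Fin 1 ↦ F)) :
    ∃ A : Matrix (Fin (3 + 1)) (Fin (3 + 1)) k, IsUnit A ∧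
      ∀ v, MvPolynomial.eval v F = MvPolynomial.eval (A *ᵥ v) (stdQuadric k) := by
  classical
  haveI : Invertible (2 : k) := invertibleOfNonzero h2
  -- the quadratic form `Q(v) = vᵀ M v = 2 F(v)`
  let B : LinearMap.BilinForm k (Fin (3 + 1) → k) := Matrix.toLinearMap₂' k (hessian F)
  have hB : ∀ x y, B x y = x ⬝ᵥ (hessian F *ᵥ y) := fun x y ↦ Matrix.toLinearMap₂'_apply' _ _ _
  have hBsymm : ∀ x y, B x y = B y x := fun x y ↦ by
    rw [hB, hB, Matrix.dotProduct_mulVec, ← Matrix.mulVec_transpose, hessian_transpose,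
      dotProduct_comm]
  let Q : QuadraticForm k (Fin (3 + 1) → k) := B.toQuadraticMap
  have hQ : ∀ v, Q v = 2 * MvPolynomial.eval v F := fun v ↦ by
    rw [LinearMap.BilinMap.toQuadraticMap_apply, hB, two_mul_eval_eq hF]
  have hassoc : QuadraticMap.associated (R := k) Q = B :=
    QuadraticMap.associated_left_inverse k hBsymm
  have hsep : (QuadraticMap.associated (R := k) Q).SeparatingLeft := by
    rw [hassoc]
    intro x hx
    have hMx : hessian F *ᵥ x = 0 := by
      funext l
      have h := hx (Pi.single l 1)
      rw [hBsymm, hB, single_dotProduct, one_mul] at h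
      exact h
    have h0 : hessian F *ᵥ x = hessian F *ᵥ 0 := by rw [hMx, Matrix.mulVec_zero]
    exact mulVec_hessian_injective hF h2 hJ h0
  -- diagonalise
  obtain ⟨w, ⟨E⟩⟩ := Q.equivalent_weightedSumSquares_units_of_nondegenerate' hsep
  have hd : Module.finrank k (Fin (3 + 1) → k) = 3 + 1 := Module.finrank_fin_fun k
  let e4 : Fin (Module.finrank k (Fin (3 + 1) → k)) ≃ Fin (3 + 1) := finCongr hd
  -- square roots of the weights and of `-1`
  have hsq : ∀ i : Fin (3 + 1), ∃ z : k, (w (e4.symm i) : k) = z * z := fun i ↦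
    IsAlgClosed.exists_eq_mul_self _
  choose s hs using hsq
  have hs0 : ∀ i, s i ≠ 0 := fun i h ↦ (w (e4.symm i)).ne_zero (by rw [hs i, h, mul_zero])
  obtain ⟨c, hc⟩ := IsAlgClosed.exists_eq_mul_self (-1 : k)
  -- the composite linear map `v ↦ L (reindex (E v))`
  let R : (Fin (Module.finrank k (Fin (3 + 1) → k)) → k) →ₗ[k] (Fin (3 + 1) → k) :=
    (LinearEquiv.funCongrLeft k k e4.symm).toLinearMap
  have hR : ∀ x i, R x i = x (e4.symm i) := fun x i ↦ rfl
  let Φ : (Fin (3 + 1) → k) →ₗ[k] (Fin (3 + 1) → k) :=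
    (toStdQuadricMap s c).comp (R.comp E.toLinearEquiv.toLinearMap)
  refine ⟨LinearMap.toMatrix' Φ, ?_, fun v ↦ ?_⟩
  · rw [← Matrix.mulVec_injective_iff_isUnit]
    have hΦ : Function.Injective Φ :=
      (toStdQuadricMap_injective hs0 hc.symm h2).comp
        ((LinearEquiv.funCongrLeft k k e4.symm).injective.comp E.toLinearEquiv.injective)
    intro x y hxy
    rw [LinearMap.toMatrix'_mulVec, LinearMap.toMatrix'_mulVec] at hxy
    exact hΦ hxy
  · rw [LinearMap.toMatrix'_mulVec]
    change MvPolynomial.eval v F =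
      MvPolynomial.eval (toStdQuadricMap s c (R (E v))) (stdQuadric k)
    rw [eval_stdQuadric_toStdQuadricMap s hc.symm h2]
    have hE := E.map_app v
    rw [QuadraticMap.weightedSumSquares_apply, hQ] at hE
    -- reindex the weighted sum of squares along `e4`
    have hsum : ∑ i, s i * s i * (R (E v) i * R (E v) i) =
        ∑ i, w i • ((E v) i * (E v) i) := by
      rw [← e4.symm.sum_comp]
      refine Finset.sum_congr rfl fun i _ ↦ ?_
      rw [hR, ← hs i, Units.smul_def, smul_eq_mul]
    rw [hsum, hE, ← mul_assoc, inv_mul_cancel₀ h2, one_mul]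

/-- **A smooth quadric surface is projectively equivalent to `x₀x₃ = x₁x₂`** (as a linear
substitution of the form): for a nonsingular quadratic form `F` in `x₀, …, x₃` over an
algebraically closed field with `2 ≠ 0` there is an invertible linear substitution `τ` (with
inverse `τ'`) such that `σ_τ(x₀x₃ - x₁x₂) = F`. [cite: Hartshorne1977, I Ex. 5.8 and II Example 6.6.1] -/
theorem exists_linearSubst_stdQuadric (h2 : (2 : k) ≠ 0) {F : MvPolynomial (Fin (3 + 1)) k}
    (hF : F.IsHomogeneous 2) (hJ : IsNonsingularSystem k (fun _ : Fin 1 ↦ F)) :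
    ∃ τ τ' : Fin (3 + 1) → MvPolynomial (Fin (3 + 1)) k,
      (∀ j, (τ j).IsHomogeneous 1) ∧ (∀ j, (τ' j).IsHomogeneous 1) ∧
        (∀ p, MvPolynomial.aeval τ (MvPolynomial.aeval τ' p) = p) ∧
          (∀ p, MvPolynomial.aeval τ' (MvPolynomial.aeval τ p) = p) ∧
            LinearIndependent k τ ∧ MvPolynomial.aeval τ (stdQuadric k) = F := by
  classical
  obtain ⟨A, hA, hAF⟩ := exists_matrix_eval_eq_eval_stdQuadric h2 hF hJ
  have hli : LinearIndependent k A.row := Matrix.linearIndependent_rows_iff_isUnit.mpr hA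
  let b := basisOfLinearIndependentOfCardEqFinrank hli (by simp)
  have hb : ∀ j, b j = A j := fun j ↦ by
    rw [coe_basisOfLinearIndependentOfCardEqFinrank]; rfl
  obtain ⟨τ', hτ, hτ', hinv, hinv', hτli⟩ := exists_linearSubst_of_basis b
  refine ⟨fun j ↦ lin (b j), τ', hτ, hτ', hinv, hinv', hτli, ?_⟩
  refine MvPolynomial.funext fun v ↦ ?_
  rw [MvPolynomial.aeval_eq_bind₁, show MvPolynomial.eval v (MvPolynomial.bind₁ (fun j ↦ lin (b j))
    (stdQuadric k)) = MvPolynomial.eval (fun j ↦ MvPolynomial.eval v (lin (b j))) (stdQuadric k)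
    from MvPolynomial.eval₂Hom_bind₁ _ _ _ _, hAF v]
  have hfun : (fun j ↦ MvPolynomial.eval v (lin (b j))) = A *ᵥ v := by
    refine _root_.funext fun j ↦ ?_
    rw [eval_lin, hb]
    rfl
  rw [hfun]

end NormalForm

end ProjectiveSpaceCells

section QuadricSurfaceFact

attribute [local instance] MvPolynomial.gradedAlgebra

/-- **Tian–Zong Thm. 1.7 for quadric surfaces.** The named fact
`TianZong2014_chowOne_generatedByLines` in the case `n = 2`, `c = 1`, `d = 2`: `CH₁` of a smooth
quadric surface `X ⊆ ℙ³` over an algebraically closed field of characteristic zero is generated by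
lines (normal form `x₀x₃ = x₁x₂`, cells `𝔸² ⊔` two lines, `A₁(𝔸²) = 0`, localisation sequence).
[cite: TianZong2014, Thm. 1.7 (quadric surfaces)] [cite: Hartshorne1977, II Example 6.6.1] -/
theorem TianZong2014_chowOne_generatedByLines_quadricSurface ⦃k : Type u⦄ [Field k] [IsAlgClosed k]
    [CharZero k] (d : Fin 1 → ℕ) ⦃X : SchemeOver k⦄ (F : Fin 1 → MvPolynomial (Fin (2 + 1 + 1)) k)
    (i : X ⟶ projectiveSpace (2 + 1) k) (hX : IsSmoothProjective 2 X)
    (hF : letI := MvPolynomial.gradedAlgebra (σ := Fin (2 + 1 + 1)) (R := k)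
      ∀ a, (F a).IsHomogeneous (d a))
    (hJ : IsNonsingularSystem k F) (hi : IsClosedImmersion i.left)
    (hV : letI := MvPolynomial.gradedAlgebra (σ := Fin (2 + 1 + 1)) (R := k)
      Set.range i.left.base =
        ProjectiveSpectrum.zeroLocus (MvPolynomial.homogeneousSubmodule (Fin (2 + 1 + 1)) k)
          (Set.range F))
    (hd2 : d 0 = 2) : ChowOneGeneratedByLines (2 + 1) i := by
  have hF2 : (F 0).IsHomogeneous 2 := by have h := hF 0; rwa [hd2] at h
  have hJ' : IsNonsingularSystem k (fun _ : Fin 1 ↦ F 0) := by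
    have : (fun _ : Fin 1 ↦ F 0) = F := funext fun a ↦ by rw [Subsingleton.elim a 0]
    rwa [this]
  obtain ⟨τ, τ', hτ, hτ', hinv, hinv', hτli, hq⟩ :=
    ProjectiveSpaceCells.exists_linearSubst_stdQuadric two_ne_zero hF2 hJ'
  have hV' : Set.range i.left.base =
      ProjectiveSpectrum.zeroLocus (MvPolynomial.homogeneousSubmodule (Fin (2 + 1 + 1)) k) {F 0} := by
    rw [hV]
    congr 1
    ext f
    simp only [Set.mem_range, Set.mem_singleton_iff]
    exact ⟨fun ⟨a, ha⟩ ↦ by rw [← ha, Subsingleton.elim a 0], fun h ↦ ⟨0, h.symm⟩⟩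
  exact ProjectiveSpaceCells.chowOneGeneratedByLines_of_projectivelyEquivalent_stdQuadric (F 0) i hX
    hi hV' τ τ' hτ hτ' hinv hinv' hτli hq

end QuadricSurfaceFact

end Literature.AlgebraicGeometry.Motives
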